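import Literature.Computability.Complexity.HardcoreInapproximabilityCyclesDisjoint
import HarnessLib

/-!
# Short cycles of Sly's random bipartite core, V: overlapping tuples and the upper bound on `E[X_i]_m`

Allan Sly, *Computational transition at the uniqueness threshold*, FOCS 2010 (arXiv:1005.5584), §3.2
(Lemma 3.7, after MWW09 Lemma 7.3; the "standard methods" made explicit).

Part IV evaluated the vertex-disjoint tuples. Here the overlapping tuples (pairwise distinct underlying
cycles, some shared vertex) are shown to contribute `O(1/n)`:

* **Edge sets** (`SlyWCycle.ES`, `|ES| = 2j`, invariance under re-rooting/reflection) and the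
  **uniqueness lemma** `SlyWCycle.mem_reps_of_ES_eq`: two rooted oriented coloured cycles with the
  same coloured edge set differ by re-rooting and reflection (induction along the cycle from a common
  first edge, `eq_of_ES_eq_of_edgeOf_zero`).
* **Union multigraph** (`slyUnionES`, `slyPlusVerts`, `slyMinusVerts`): bipartite handshake and
  minimum degree two give `|U| ≥ |V⁺| + |V⁻|` (`card_verts_le_card_slyUnionES`); if equality held, all
  degrees would be two, a shared vertex would give a shared edge and then (propagation
  `ES_subset_of_shared_edge`) equal edge sets, hence equal underlying cycles — so for overlapping tuples
  with distinct underlying cycles `|U| ≥ |V⁺| + |V⁻| + 1` (`card_verts_lt_card_slyUnionES`).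
* **Probability of the union** (`card_present_tuple_mul_pow_le`): `#{ω ⊇ U} (n-2mj)^{|U|} ≤ N_tot`
  (colour classes of a realisable edge set are partial matchings).
* **Counting** (`card_tuples_verts_le`): at most `C(n,a)C(n,b)(a^j b^j (q+1)^{2j})^m` tuples have
  vertex counts `(a, b)`.
* **Conclusion** (`sum_overlap_le`, `avg_slyDistinctTuples_le`): with `x = n - 2mj`,
  `E[(2j)^m (X_{2j})_m] ≤ (q^{2j}+q)^m (n/x)^{2mj} + (mj+1)² ((mj)^{2j}(q+1)^{2j})^m (n/x)^{2mj}/x`,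
  complementing `avg_slyDistinctTuples_ge` of part IV: Lemma 3.7's `E[X_i]_m → λ_i^m` with explicit
  rates. No named facts.

[cite: Sly2010, Lemma 3.7]
-/

namespace Literature.Computability.Complexity

open Finset

section EdgeSetBasics

variable {n q j : ℕ}

/-- The coloured edge `(colour, plus end, minus end)` of an edge index. [folklore] -/
def SlyWCycle.edgeOf (C : SlyWCycle n q j) (e : Fin j ⊕ Fin j) : Option (Fin q) × Fin n × Fin n :=
  (C.colour e, C.plusEnd e, C.minusEnd e)

/-- Unfolding `edgeOf` at `inl t`: the edge `v_t — w_t` of colour `a_t`. [folklore] -/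
theorem SlyWCycle.edgeOf_inl (C : SlyWCycle n q j) (t : Fin j) : C.edgeOf (Sum.inl t) = (C.a t, C.v t, C.w t) := rfl

/-- Unfolding `edgeOf` at `inr t`: the edge `v_{t+1} — w_t` of colour `b_t`. [folklore] -/
theorem SlyWCycle.edgeOf_inr (C : SlyWCycle n q j) (t : Fin j) : C.edgeOf (Sum.inr t) = (C.b t, C.v (finRotate j t), C.w t) := rfl

/-- The `2j` coloured edges of a cycle are distinct. [folklore] -/
theorem SlyWCycle.edgeOf_injective (C : SlyWCycle n q j) : Function.Injective C.edgeOf := by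
  intro e e' h
  rcases e with t | t <;> rcases e' with t' | t'
  · rw [SlyWCycle.edgeOf_inl, SlyWCycle.edgeOf_inl] at h
    rw [C.hv (Prod.mk.inj (Prod.mk.inj h).2).1]
  · rw [SlyWCycle.edgeOf_inl, SlyWCycle.edgeOf_inr] at h
    have hw : t = t' := C.hw (Prod.mk.inj (Prod.mk.inj h).2).2
    subst hw
    have hv : t = finRotate j t := C.hv (Prod.mk.inj (Prod.mk.inj h).2).1
    exact absurd ((Prod.mk.inj h).1.trans (congrArg C.b rfl)) (by rw [show C.b t = C.b t from rfl]; exact fun h' => C.hab t (h'.trans rfl))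
  · rw [SlyWCycle.edgeOf_inl, SlyWCycle.edgeOf_inr] at h
    have hw : t' = t := C.hw (Prod.mk.inj (Prod.mk.inj h).2).2.symm
    subst hw
    exact absurd (Prod.mk.inj h).1.symm (C.hab t')
  · rw [SlyWCycle.edgeOf_inr, SlyWCycle.edgeOf_inr] at h
    rw [C.hw (Prod.mk.inj (Prod.mk.inj h).2).2]

/-- **The coloured edge set** `ES(C)` of a rooted oriented cycle. [folklore] -/
noncomputable def SlyWCycle.ES (C : SlyWCycle n q j) : Finset (Option (Fin q) × Fin n × Fin n) :=
  univ.image C.edgeOf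

/-- Membership in the edge set. [folklore] -/
theorem SlyWCycle.mem_ES {C : SlyWCycle n q j} {ε : Option (Fin q) × Fin n × Fin n} : ε ∈ C.ES ↔ ∃ e, C.edgeOf e = ε := by
  simp [SlyWCycle.ES]

/-- `edgeOf e ∈ ES`. [folklore] -/
theorem SlyWCycle.edgeOf_mem_ES (C : SlyWCycle n q j) (e : Fin j ⊕ Fin j) : C.edgeOf e ∈ C.ES :=
  SlyWCycle.mem_ES.2 ⟨e, rfl⟩

/-- `|ES(C)| = 2j`. [folklore] -/
theorem SlyWCycle.card_ES (C : SlyWCycle n q j) : C.ES.card = 2 * j := by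
  rw [SlyWCycle.ES, Finset.card_image_of_injective _ C.edgeOf_injective, Finset.card_univ, Fintype.card_sum, Fintype.card_fin]
  ring

/-- **Degree two at a plus vertex, explicitly**: an edge of `ES(C)` with plus endpoint `v_t` is
`v_t — w_t` (colour `a_t`) or `v_t — w_{t-1}` (colour `b_{t-1}`). [folklore] -/
theorem SlyWCycle.eq_of_mem_ES_plus {C : SlyWCycle n q j} {ε : Option (Fin q) × Fin n × Fin n} (hε : ε ∈ C.ES) {t : Fin j}
    (ht : ε.2.1 = C.v t) : ε = C.edgeOf (Sum.inl t) ∨ ε = C.edgeOf (Sum.inr ((finRotate j).symm t)) := by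
  obtain ⟨e, rfl⟩ := SlyWCycle.mem_ES.1 hε
  rcases e with s | s
  · left; rw [SlyWCycle.edgeOf_inl] at ht; rw [C.hv ht]
  · right
    rw [SlyWCycle.edgeOf_inr] at ht
    have hs : finRotate j s = t := C.hv ht
    rw [← hs, Equiv.symm_apply_apply]

/-- **Degree two at a minus vertex, explicitly**: an edge of `ES(C)` with minus endpoint `w_t` is
`v_t — w_t` (colour `a_t`) or `v_{t+1} — w_t` (colour `b_t`). [folklore] -/
theorem SlyWCycle.eq_of_mem_ES_minus {C : SlyWCycle n q j} {ε : Option (Fin q) × Fin n × Fin n} (hε : ε ∈ C.ES) {t : Fin j}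
    (ht : ε.2.2 = C.w t) : ε = C.edgeOf (Sum.inl t) ∨ ε = C.edgeOf (Sum.inr t) := by
  obtain ⟨e, rfl⟩ := SlyWCycle.mem_ES.1 hε
  rcases e with s | s
  · left; rw [SlyWCycle.edgeOf_inl] at ht; rw [C.hw ht]
  · right; rw [SlyWCycle.edgeOf_inr] at ht; rw [C.hw ht]

/-- Rotation permutes the edge indices. [folklore] -/
theorem SlyWCycle.edgeOf_rotate (C : SlyWCycle n q j) (e : Fin j ⊕ Fin j) :
    C.rotate.edgeOf e = C.edgeOf (Sum.map (finRotate j) (finRotate j) e) := by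
  rcases e with t | t <;> rfl

/-- `ES` is invariant under re-rooting. [folklore] -/
theorem SlyWCycle.ES_rotate (C : SlyWCycle n q j) : C.rotate.ES = C.ES := by
  ext ε
  simp only [SlyWCycle.mem_ES, SlyWCycle.edgeOf_rotate]
  constructor
  · rintro ⟨e, rfl⟩; exact ⟨_, rfl⟩
  · rintro ⟨e, rfl⟩
    refine ⟨Sum.map (finRotate j).symm (finRotate j).symm e, ?_⟩
    rcases e with t | t <;> simp only [Sum.map_inl, Sum.map_inr, Equiv.apply_symm_apply]

/-- `ES` is invariant under iterated re-rooting. [folklore] -/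
theorem SlyWCycle.ES_iterate_rotate (C : SlyWCycle n q j) (s : ℕ) : (SlyWCycle.rotate^[s] C).ES = C.ES := by
  induction s with
  | zero => rfl
  | succ s ih => rw [Function.iterate_succ_apply', SlyWCycle.ES_rotate, ih]

/-- Reflection maps the edge indices `inl t ↦ inr (rev t)`, `inr t ↦ inl (rev t)`. [folklore] -/
theorem SlyWCycle.edgeOf_reflect_inl (C : SlyWCycle n q j) (t : Fin j) :
    C.reflect.edgeOf (Sum.inl t) = C.edgeOf (Sum.inr (Fin.rev t)) := rfl

/-- See `edgeOf_reflect_inl`. [folklore] -/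
theorem SlyWCycle.edgeOf_reflect_inr (C : SlyWCycle n q j) (t : Fin j) :
    C.reflect.edgeOf (Sum.inr t) = C.edgeOf (Sum.inl (Fin.rev t)) := by
  rw [SlyWCycle.edgeOf_inr, SlyWCycle.edgeOf_inl]
  show (C.a (Fin.rev t), C.v (finRotate j (Fin.rev (finRotate j t))), C.w (Fin.rev t)) = _
  rw [finRotate_rev_finRotate]

/-- `ES` is invariant under reflection. [folklore] -/
theorem SlyWCycle.ES_reflect (C : SlyWCycle n q j) : C.reflect.ES = C.ES := by
  ext ε
  simp only [SlyWCycle.mem_ES]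
  constructor
  · rintro ⟨e, rfl⟩
    rcases e with t | t
    · exact ⟨_, (C.edgeOf_reflect_inl t).symm⟩
    · exact ⟨_, (C.edgeOf_reflect_inr t).symm⟩
  · rintro ⟨e, rfl⟩
    rcases e with t | t
    · refine ⟨Sum.inr (Fin.rev t), ?_⟩; rw [SlyWCycle.edgeOf_reflect_inr, Fin.rev_rev]
    · refine ⟨Sum.inl (Fin.rev t), ?_⟩; rw [SlyWCycle.edgeOf_reflect_inl, Fin.rev_rev]

/-- Representatives have the same edge set. [folklore] -/
theorem SlyWCycle.ES_eq_of_mem_reps {C D : SlyWCycle n q j} (h : D ∈ C.reps) : D.ES = C.ES := by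
  obtain ⟨s, e, rfl⟩ := SlyWCycle.mem_reps.1 h
  rw [SlyWCycle.ES_iterate_rotate]
  cases e
  · rfl
  · exact C.ES_reflect

/-- A cycle is determined by its edge function. [folklore] -/
theorem SlyWCycle.ext_of_edgeOf {C D : SlyWCycle n q j} (h : ∀ e, C.edgeOf e = D.edgeOf e) : C = D := by
  refine SlyWCycle.ext' (funext fun t => ?_) (funext fun t => ?_) (funext fun t => ?_) (funext fun t => ?_)
  · have := h (Sum.inl t); rw [SlyWCycle.edgeOf_inl, SlyWCycle.edgeOf_inl] at this; exact (Prod.mk.inj (Prod.mk.inj this).2).1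
  · have := h (Sum.inl t); rw [SlyWCycle.edgeOf_inl, SlyWCycle.edgeOf_inl] at this; exact (Prod.mk.inj (Prod.mk.inj this).2).2
  · have := h (Sum.inl t); rw [SlyWCycle.edgeOf_inl, SlyWCycle.edgeOf_inl] at this; exact (Prod.mk.inj this).1
  · have := h (Sum.inr t); rw [SlyWCycle.edgeOf_inr, SlyWCycle.edgeOf_inr] at this; exact (Prod.mk.inj this).1

end EdgeSetBasics

section EdgeSetUniqueness

variable {n q j : ℕ}

/-- The value of `finRotate`. [folklore] -/
theorem finRotate_val_eq (t : Fin j) : ((finRotate j t : Fin j) : ℕ) = ((t : ℕ) + 1) % j := by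
  have h := iterate_finRotate_val 1 t
  rwa [Function.iterate_one] at h

/-- Propagation along the cycle, first half-step: agreement of the `a`-edge at `t` forces agreement of
the `b`-edge at `t` (degree two at `w_t`). [folklore] -/
theorem SlyWCycle.edgeOf_inr_eq_of_inl {C D : SlyWCycle n q j} (hES : C.ES = D.ES) (t : Fin j)
    (h : C.edgeOf (Sum.inl t) = D.edgeOf (Sum.inl t)) : C.edgeOf (Sum.inr t) = D.edgeOf (Sum.inr t) := by
  have hmem : D.edgeOf (Sum.inr t) ∈ C.ES := hES ▸ D.edgeOf_mem_ES _
  have hw : (D.edgeOf (Sum.inr t)).2.2 = C.w t := by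
    have := congrArg (fun ε : Option (Fin q) × Fin n × Fin n => ε.2.2) h
    simp only [SlyWCycle.edgeOf_inl] at this
    rw [SlyWCycle.edgeOf_inr]; exact this.symm
  rcases SlyWCycle.eq_of_mem_ES_minus hmem hw with h1 | h1
  · exfalso
    rw [h] at h1
    exact absurd (D.edgeOf_injective h1) (by simp)
  · exact h1.symm

/-- Propagation along the cycle, second half-step: agreement of the `b`-edge at `t` forces agreement of
the `a`-edge at `t+1` (degree two at `v_{t+1}`). [folklore] -/
theorem SlyWCycle.edgeOf_inl_eq_of_inr {C D : SlyWCycle n q j} (hES : C.ES = D.ES) (t : Fin j)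
    (h : C.edgeOf (Sum.inr t) = D.edgeOf (Sum.inr t)) :
    C.edgeOf (Sum.inl (finRotate j t)) = D.edgeOf (Sum.inl (finRotate j t)) := by
  have hmem : D.edgeOf (Sum.inl (finRotate j t)) ∈ C.ES := hES ▸ D.edgeOf_mem_ES _
  have hv : (D.edgeOf (Sum.inl (finRotate j t))).2.1 = C.v (finRotate j t) := by
    have := congrArg (fun ε : Option (Fin q) × Fin n × Fin n => ε.2.1) h
    simp only [SlyWCycle.edgeOf_inr] at this
    rw [SlyWCycle.edgeOf_inl]; exact this.symm
  rcases SlyWCycle.eq_of_mem_ES_plus hmem hv with h1 | h1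
  · exact h1.symm
  · exfalso
    rw [Equiv.symm_apply_apply, h] at h1
    exact absurd (D.edgeOf_injective h1) (by simp)

/-- **A rooted oriented cycle is determined by its edge set and its first edge.** [folklore] -/
theorem SlyWCycle.eq_of_ES_eq_of_edgeOf_zero {j : ℕ} {C D : SlyWCycle n q (j + 1)} (hES : C.ES = D.ES)
    (h0 : C.edgeOf (Sum.inl 0) = D.edgeOf (Sum.inl 0)) : C = D := by
  have key : ∀ t : ℕ, ∀ ht : t < j + 1,
      C.edgeOf (Sum.inl ⟨t, ht⟩) = D.edgeOf (Sum.inl ⟨t, ht⟩) ∧ C.edgeOf (Sum.inr ⟨t, ht⟩) = D.edgeOf (Sum.inr ⟨t, ht⟩) := by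
    intro t
    induction t with
    | zero => intro ht; exact ⟨h0, SlyWCycle.edgeOf_inr_eq_of_inl hES _ h0⟩
    | succ t ih =>
      intro ht
      have ih' := ih (by omega)
      have hfr : finRotate (j + 1) ⟨t, by omega⟩ = ⟨t + 1, ht⟩ := by
        apply Fin.ext; rw [finRotate_val_eq]; exact Nat.mod_eq_of_lt ht
      have h1 := SlyWCycle.edgeOf_inl_eq_of_inr hES _ ih'.2
      rw [hfr] at h1
      exact ⟨h1, SlyWCycle.edgeOf_inr_eq_of_inl hES _ h1⟩
  refine SlyWCycle.ext_of_edgeOf fun e => ?_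
  rcases e with t | t
  · exact (key t t.isLt).1
  · exact (key t t.isLt).2

/-- **Uniqueness: the edge set determines the underlying cycle** — two rooted oriented coloured cycles
with the same coloured edge set differ by re-rooting and reflection. [folklore] -/
theorem SlyWCycle.mem_reps_of_ES_eq (hj : 0 < j) {C D : SlyWCycle n q j} (h : D.ES = C.ES) : D ∈ C.reps := by
  obtain ⟨j, rfl⟩ : ∃ j', j = j' + 1 := ⟨j - 1, by omega⟩
  -- the root of `D` is a plus vertex of `C`
  have h0 : D.edgeOf (Sum.inl 0) ∈ C.ES := h ▸ D.edgeOf_mem_ES _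
  obtain ⟨e, he⟩ := SlyWCycle.mem_ES.1 h0
  have hvs : C.v (slyPlusIdx (j + 1) e) = D.v 0 := by
    have := congrArg (fun ε : Option (Fin q) × Fin n × Fin n => ε.2.1) he
    simp only [SlyWCycle.edgeOf] at this
    rw [← SlyWCycle.plusEnd_eq]; exact this
  set s : Fin (j + 1) := slyPlusIdx (j + 1) e with hs
  -- re-root `C` at that vertex
  set C₁ : SlyWCycle n q (j + 1) := SlyWCycle.rotate^[(s : ℕ)] C with hC₁
  have hC₁ES : C₁.ES = C.ES := C.ES_iterate_rotate _
  have hC₁v : C₁.v 0 = D.v 0 := by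
    rw [hC₁, SlyWCycle.iterate_rotate_v]
    show C.v ((finRotate (j + 1))^[(s : ℕ)] 0) = D.v 0
    have : (finRotate (j + 1))^[(s : ℕ)] 0 = s := Fin.ext (by rw [iterate_finRotate_val]; simp [Nat.mod_eq_of_lt s.isLt])
    rw [this, hvs]
  have hC₁reps : C₁ ∈ C.reps := SlyWCycle.mem_reps.2 ⟨s, false, rfl⟩
  -- the first edge of `D` is one of the two edges of `C₁` at the common root
  have hmem : D.edgeOf (Sum.inl 0) ∈ C₁.ES := by rw [hC₁ES, ← h]; exact D.edgeOf_mem_ES _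
  rcases SlyWCycle.eq_of_mem_ES_plus hmem (t := 0) (by rw [SlyWCycle.edgeOf_inl]; exact hC₁v.symm) with hA | hB
  · -- same orientation
    have : C₁ = D := SlyWCycle.eq_of_ES_eq_of_edgeOf_zero (by rw [hC₁ES, h]) hA.symm
    rw [← this]; exact hC₁reps
  · -- opposite orientation: reflect
    have hlast : (finRotate (j + 1)).symm 0 = Fin.rev 0 := by
      rw [Equiv.symm_apply_eq, Fin.rev_zero, finRotate_last]
    rw [hlast, ← SlyWCycle.edgeOf_reflect_inl] at hB
    have hES2 : C₁.reflect.ES = D.ES := by rw [SlyWCycle.ES_reflect, hC₁ES, h]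
    have : C₁.reflect = D := SlyWCycle.eq_of_ES_eq_of_edgeOf_zero hES2 hB.symm
    rw [← this, ← SlyWCycle.reps_eq_of_mem_reps hj hC₁reps]
    exact SlyWCycle.mem_reps.2 ⟨0, true, rfl⟩

end EdgeSetUniqueness

section UnionDegrees

variable {n q j : ℕ}

/-- The union of the coloured edge sets of a tuple of cycles. [folklore] -/
noncomputable def slyUnionES {m : ℕ} (f : Fin m → SlyWCycle n q j) : Finset (Option (Fin q) × Fin n × Fin n) :=
  univ.biUnion fun k => (f k).ES

/-- The plus vertices of a tuple. [folklore] -/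
noncomputable def slyPlusVerts {m : ℕ} (f : Fin m → SlyWCycle n q j) : Finset (Fin n) :=
  univ.image fun p : Fin m × Fin j => (f p.1).v p.2

/-- The minus vertices of a tuple. [folklore] -/
noncomputable def slyMinusVerts {m : ℕ} (f : Fin m → SlyWCycle n q j) : Finset (Fin n) :=
  univ.image fun p : Fin m × Fin j => (f p.1).w p.2

/-- Each member's edge set is contained in the union. [folklore] -/
theorem ES_subset_slyUnionES {m : ℕ} (f : Fin m → SlyWCycle n q j) (k : Fin m) : (f k).ES ⊆ slyUnionES f :=
  Finset.subset_biUnion_of_mem (fun k => (f k).ES) (Finset.mem_univ k)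

/-- Membership in the union edge set. [folklore] -/
theorem mem_slyUnionES {m : ℕ} {f : Fin m → SlyWCycle n q j} {ε : Option (Fin q) × Fin n × Fin n} :
    ε ∈ slyUnionES f ↔ ∃ k e, (f k).edgeOf e = ε := by
  simp [slyUnionES, SlyWCycle.mem_ES]

/-- `|U| ≤ 2mj`. [folklore] -/
theorem card_slyUnionES_le {m : ℕ} (f : Fin m → SlyWCycle n q j) : (slyUnionES f).card ≤ 2 * (m * j) := by
  unfold slyUnionES
  refine Finset.card_biUnion_le.trans ?_
  simp_rw [SlyWCycle.card_ES]
  rw [Finset.sum_const, Finset.card_univ, Fintype.card_fin, smul_eq_mul]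
  exact le_of_eq (by ring)

/-- Plus vertices of members are plus vertices of the tuple. [folklore] -/
theorem v_mem_slyPlusVerts {m : ℕ} (f : Fin m → SlyWCycle n q j) (k : Fin m) (t : Fin j) : (f k).v t ∈ slyPlusVerts f :=
  Finset.mem_image.2 ⟨(k, t), Finset.mem_univ _, rfl⟩

/-- Minus vertices of members are minus vertices of the tuple. [folklore] -/
theorem w_mem_slyMinusVerts {m : ℕ} (f : Fin m → SlyWCycle n q j) (k : Fin m) (t : Fin j) : (f k).w t ∈ slyMinusVerts f :=
  Finset.mem_image.2 ⟨(k, t), Finset.mem_univ _, rfl⟩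

/-- `|V⁺| ≤ mj`. [folklore] -/
theorem card_slyPlusVerts_le {m : ℕ} (f : Fin m → SlyWCycle n q j) : (slyPlusVerts f).card ≤ m * j := by
  unfold slyPlusVerts
  refine Finset.card_image_le.trans ?_
  rw [Finset.card_univ, Fintype.card_prod, Fintype.card_fin, Fintype.card_fin]

/-- `|V⁻| ≤ mj`. [folklore] -/
theorem card_slyMinusVerts_le {m : ℕ} (f : Fin m → SlyWCycle n q j) : (slyMinusVerts f).card ≤ m * j := by
  unfold slyMinusVerts
  refine Finset.card_image_le.trans ?_
  rw [Finset.card_univ, Fintype.card_prod, Fintype.card_fin, Fintype.card_fin]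

/-- Plus endpoints of union edges are plus vertices. [folklore] -/
theorem plus_mem_of_mem_slyUnionES {m : ℕ} {f : Fin m → SlyWCycle n q j} {ε : Option (Fin q) × Fin n × Fin n}
    (h : ε ∈ slyUnionES f) : ε.2.1 ∈ slyPlusVerts f := by
  obtain ⟨k, e, rfl⟩ := mem_slyUnionES.1 h
  show (f k).plusEnd e ∈ _
  rw [SlyWCycle.plusEnd_eq]; exact v_mem_slyPlusVerts f k _

/-- Minus endpoints of union edges are minus vertices. [folklore] -/
theorem minus_mem_of_mem_slyUnionES {m : ℕ} {f : Fin m → SlyWCycle n q j} {ε : Option (Fin q) × Fin n × Fin n}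
    (h : ε ∈ slyUnionES f) : ε.2.2 ∈ slyMinusVerts f := by
  obtain ⟨k, e, rfl⟩ := mem_slyUnionES.1 h
  show (f k).minusEnd e ∈ _
  rw [SlyWCycle.minusEnd_eq]; exact w_mem_slyMinusVerts f k _

/-- **Bipartite handshake, plus side**: `|U| = Σ_{x ∈ V⁺} deg⁺(x)`. [folklore] -/
theorem card_slyUnionES_eq_sum_plus {m : ℕ} (f : Fin m → SlyWCycle n q j) :
    (slyUnionES f).card = ∑ x ∈ slyPlusVerts f, ((slyUnionES f).filter fun ε => ε.2.1 = x).card :=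
  Finset.card_eq_sum_card_fiberwise fun _ hε => plus_mem_of_mem_slyUnionES (Finset.mem_coe.1 hε)

/-- **Bipartite handshake, minus side**: `|U| = Σ_{y ∈ V⁻} deg⁻(y)`. [folklore] -/
theorem card_slyUnionES_eq_sum_minus {m : ℕ} (f : Fin m → SlyWCycle n q j) :
    (slyUnionES f).card = ∑ y ∈ slyMinusVerts f, ((slyUnionES f).filter fun ε => ε.2.2 = y).card :=
  Finset.card_eq_sum_card_fiberwise fun _ hε => minus_mem_of_mem_slyUnionES (Finset.mem_coe.1 hε)

/-- The two edges of `C` at its plus vertex `v_t` are distinct. [folklore] -/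
theorem SlyWCycle.edgeOf_inl_ne_inr (C : SlyWCycle n q j) (t s : Fin j) : C.edgeOf (Sum.inl t) ≠ C.edgeOf (Sum.inr s) :=
  fun h => by simpa using C.edgeOf_injective h

/-- **Every plus vertex has degree at least two in the union.** [folklore] -/
theorem two_le_plusDeg {m : ℕ} (f : Fin m → SlyWCycle n q j) {x : Fin n} (hx : x ∈ slyPlusVerts f) :
    2 ≤ ((slyUnionES f).filter fun ε => ε.2.1 = x).card := by
  obtain ⟨⟨k, t⟩, -, rfl⟩ := Finset.mem_image.1 hx
  have hsub : ({(f k).edgeOf (Sum.inl t), (f k).edgeOf (Sum.inr ((finRotate j).symm t))} : Finset _) ⊆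
      (slyUnionES f).filter fun ε => ε.2.1 = (f k).v t := by
    intro ε hε
    rw [Finset.mem_insert, Finset.mem_singleton] at hε
    rw [Finset.mem_filter]
    rcases hε with rfl | rfl
    · exact ⟨ES_subset_slyUnionES f k ((f k).edgeOf_mem_ES _), rfl⟩
    · refine ⟨ES_subset_slyUnionES f k ((f k).edgeOf_mem_ES _), ?_⟩
      show (f k).v (finRotate j ((finRotate j).symm t)) = (f k).v t
      rw [Equiv.apply_symm_apply]
  refine le_trans ?_ (Finset.card_le_card hsub)
  rw [Finset.card_pair ((f k).edgeOf_inl_ne_inr t _)]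

/-- **Every minus vertex has degree at least two in the union.** [folklore] -/
theorem two_le_minusDeg {m : ℕ} (f : Fin m → SlyWCycle n q j) {y : Fin n} (hy : y ∈ slyMinusVerts f) :
    2 ≤ ((slyUnionES f).filter fun ε => ε.2.2 = y).card := by
  obtain ⟨⟨k, t⟩, -, rfl⟩ := Finset.mem_image.1 hy
  have hsub : ({(f k).edgeOf (Sum.inl t), (f k).edgeOf (Sum.inr t)} : Finset _) ⊆
      (slyUnionES f).filter fun ε => ε.2.2 = (f k).w t := by
    intro ε hε
    rw [Finset.mem_insert, Finset.mem_singleton] at hε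
    rw [Finset.mem_filter]
    rcases hε with rfl | rfl
    · exact ⟨ES_subset_slyUnionES f k ((f k).edgeOf_mem_ES _), rfl⟩
    · exact ⟨ES_subset_slyUnionES f k ((f k).edgeOf_mem_ES _), rfl⟩
  refine le_trans ?_ (Finset.card_le_card hsub)
  rw [Finset.card_pair ((f k).edgeOf_inl_ne_inr t t)]

/-- **`e ≥ v`**: the union has at least as many edges as vertices (`v = |V⁺| + |V⁻|`), since
`|U| ≥ 2|V⁺|` and `|U| ≥ 2|V⁻|`. [folklore] -/
theorem card_verts_le_card_slyUnionES {m : ℕ} (f : Fin m → SlyWCycle n q j) :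
    2 * (slyPlusVerts f).card ≤ (slyUnionES f).card ∧ 2 * (slyMinusVerts f).card ≤ (slyUnionES f).card := by
  constructor
  · rw [card_slyUnionES_eq_sum_plus]
    calc 2 * (slyPlusVerts f).card = ∑ _x ∈ slyPlusVerts f, 2 := by rw [Finset.sum_const, smul_eq_mul, mul_comm]
      _ ≤ _ := Finset.sum_le_sum fun x hx => two_le_plusDeg f hx
  · rw [card_slyUnionES_eq_sum_minus]
    calc 2 * (slyMinusVerts f).card = ∑ _y ∈ slyMinusVerts f, 2 := by rw [Finset.sum_const, smul_eq_mul, mul_comm]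
      _ ≤ _ := Finset.sum_le_sum fun y hy => two_le_minusDeg f hy

end UnionDegrees

section Propagation

variable {n q j : ℕ}

/-- **If `e ≤ v` then every vertex of the union has degree exactly two.** [folklore] -/
theorem degTwo_of_card_le {m : ℕ} (f : Fin m → SlyWCycle n q j)
    (h : (slyUnionES f).card ≤ (slyPlusVerts f).card + (slyMinusVerts f).card) :
    (∀ x ∈ slyPlusVerts f, ((slyUnionES f).filter fun ε => ε.2.1 = x).card = 2) ∧
      ∀ y ∈ slyMinusVerts f, ((slyUnionES f).filter fun ε => ε.2.2 = y).card = 2 := by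
  obtain ⟨h1, h2⟩ := card_verts_le_card_slyUnionES f
  have hp : (slyUnionES f).card = 2 * (slyPlusVerts f).card := by omega
  have hm : (slyUnionES f).card = 2 * (slyMinusVerts f).card := by omega
  constructor
  · have hs : (∑ _x ∈ slyPlusVerts f, 2) = ∑ x ∈ slyPlusVerts f, ((slyUnionES f).filter fun ε => ε.2.1 = x).card := by
      rw [← card_slyUnionES_eq_sum_plus, Finset.sum_const, smul_eq_mul, mul_comm, hp]
    intro x hx
    exact ((Finset.sum_eq_sum_iff_of_le fun x hx => two_le_plusDeg f hx).1 hs x hx).symm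
  · have hs : (∑ _y ∈ slyMinusVerts f, 2) = ∑ y ∈ slyMinusVerts f, ((slyUnionES f).filter fun ε => ε.2.2 = y).card := by
      rw [← card_slyUnionES_eq_sum_minus, Finset.sum_const, smul_eq_mul, mul_comm, hm]
    intro y hy
    exact ((Finset.sum_eq_sum_iff_of_le fun y hy => two_le_minusDeg f hy).1 hs y hy).symm

/-- Two two-element subsets of a two-element set coincide: the degree-two transfer. [folklore] -/
theorem pair_eq_pair_of_subset {α : Type*} [DecidableEq α] {F : Finset α} (hF : F.card = 2) {a b c d : α}
    (hab : a ≠ b) (hcd : c ≠ d) (h1 : ({a, b} : Finset α) ⊆ F) (h2 : ({c, d} : Finset α) ⊆ F) :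
    ({a, b} : Finset α) = {c, d} := by
  have e1 : ({a, b} : Finset α) = F := Finset.eq_of_subset_of_card_le h1 (by rw [hF, Finset.card_pair hab])
  have e2 : ({c, d} : Finset α) = F := Finset.eq_of_subset_of_card_le h2 (by rw [hF, Finset.card_pair hcd])
  rw [e1, e2]

/-- Propagation step at a minus vertex of degree two: if the `a`-edge of `C` at `t` is an edge of `D`,
so is the `b`-edge of `C` at `t`. [folklore] -/
theorem SlyWCycle.inr_mem_of_inl_mem {j' : ℕ} {C : SlyWCycle n q j} {D : SlyWCycle n q j'} {U : Finset (Option (Fin q) × Fin n × Fin n)}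
    (hCU : C.ES ⊆ U) (hDU : D.ES ⊆ U) (t : Fin j) (hdeg : (U.filter fun ε => ε.2.2 = C.w t).card = 2)
    (h : C.edgeOf (Sum.inl t) ∈ D.ES) : C.edgeOf (Sum.inr t) ∈ D.ES := by
  obtain ⟨e'', he''⟩ := SlyWCycle.mem_ES.1 h
  set t'' := slyMinusIdx j' e''
  have hy : D.w t'' = C.w t := by
    have := congrArg (fun ε : Option (Fin q) × Fin n × Fin n => ε.2.2) he''
    simp only [SlyWCycle.edgeOf] at this
    rw [← SlyWCycle.minusEnd_eq]; exact this
  have hP : ({C.edgeOf (Sum.inl t), C.edgeOf (Sum.inr t)} : Finset _) ⊆ U.filter fun ε => ε.2.2 = C.w t := by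
    intro ε hε; rw [Finset.mem_insert, Finset.mem_singleton] at hε; rw [Finset.mem_filter]
    rcases hε with rfl | rfl
    · exact ⟨hCU (C.edgeOf_mem_ES _), rfl⟩
    · exact ⟨hCU (C.edgeOf_mem_ES _), rfl⟩
  have hPD : ({D.edgeOf (Sum.inl t''), D.edgeOf (Sum.inr t'')} : Finset _) ⊆ U.filter fun ε => ε.2.2 = C.w t := by
    intro ε hε; rw [Finset.mem_insert, Finset.mem_singleton] at hε; rw [Finset.mem_filter]
    rcases hε with rfl | rfl
    · exact ⟨hDU (D.edgeOf_mem_ES _), hy⟩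
    · exact ⟨hDU (D.edgeOf_mem_ES _), hy⟩
  have heq := pair_eq_pair_of_subset hdeg (C.edgeOf_inl_ne_inr t t) (D.edgeOf_inl_ne_inr t'' t'') hP hPD
  have : C.edgeOf (Sum.inr t) ∈ ({D.edgeOf (Sum.inl t''), D.edgeOf (Sum.inr t'')} : Finset _) := by
    rw [← heq]; simp
  rw [Finset.mem_insert, Finset.mem_singleton] at this
  rcases this with h1 | h1 <;> rw [h1] <;> exact D.edgeOf_mem_ES _

/-- Propagation step at a plus vertex of degree two: if the `b`-edge of `C` at `t` is an edge of `D`,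
so is the `a`-edge of `C` at `t+1`. [folklore] -/
theorem SlyWCycle.inl_mem_of_inr_mem {j' : ℕ} {C : SlyWCycle n q j} {D : SlyWCycle n q j'} {U : Finset (Option (Fin q) × Fin n × Fin n)}
    (hCU : C.ES ⊆ U) (hDU : D.ES ⊆ U) (t : Fin j) (hdeg : (U.filter fun ε => ε.2.1 = C.v (finRotate j t)).card = 2)
    (h : C.edgeOf (Sum.inr t) ∈ D.ES) : C.edgeOf (Sum.inl (finRotate j t)) ∈ D.ES := by
  obtain ⟨e'', he''⟩ := SlyWCycle.mem_ES.1 h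
  set t'' := slyPlusIdx j' e''
  have hx : D.v t'' = C.v (finRotate j t) := by
    have := congrArg (fun ε : Option (Fin q) × Fin n × Fin n => ε.2.1) he''
    simp only [SlyWCycle.edgeOf] at this
    rw [← SlyWCycle.plusEnd_eq]; exact this
  have hP : ({C.edgeOf (Sum.inl (finRotate j t)), C.edgeOf (Sum.inr t)} : Finset _) ⊆
      U.filter fun ε => ε.2.1 = C.v (finRotate j t) := by
    intro ε hε; rw [Finset.mem_insert, Finset.mem_singleton] at hε; rw [Finset.mem_filter]
    rcases hε with rfl | rfl
    · exact ⟨hCU (C.edgeOf_mem_ES _), rfl⟩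
    · exact ⟨hCU (C.edgeOf_mem_ES _), rfl⟩
  have hPD : ({D.edgeOf (Sum.inl t''), D.edgeOf (Sum.inr ((finRotate j').symm t''))} : Finset _) ⊆
      U.filter fun ε => ε.2.1 = C.v (finRotate j t) := by
    intro ε hε; rw [Finset.mem_insert, Finset.mem_singleton] at hε; rw [Finset.mem_filter]
    rcases hε with rfl | rfl
    · exact ⟨hDU (D.edgeOf_mem_ES _), hx⟩
    · refine ⟨hDU (D.edgeOf_mem_ES _), ?_⟩
      show D.v (finRotate j' ((finRotate j').symm t'')) = _
      rw [Equiv.apply_symm_apply, hx]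
  have heq := pair_eq_pair_of_subset hdeg (C.edgeOf_inl_ne_inr _ t) (D.edgeOf_inl_ne_inr t'' _) hP hPD
  have : C.edgeOf (Sum.inl (finRotate j t)) ∈ ({D.edgeOf (Sum.inl t''), D.edgeOf (Sum.inr ((finRotate j').symm t''))} : Finset _) := by
    rw [← heq]; simp
  rw [Finset.mem_insert, Finset.mem_singleton] at this
  rcases this with h1 | h1 <;> rw [h1] <;> exact D.edgeOf_mem_ES _

/-- Edge indices of an iterated re-rooting. [folklore] -/
theorem SlyWCycle.edgeOf_iterate_rotate (C : SlyWCycle n q j) (s : ℕ) (e : Fin j ⊕ Fin j) :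
    (SlyWCycle.rotate^[s] C).edgeOf e = C.edgeOf (Sum.map (finRotate j)^[s] (finRotate j)^[s] e) := by
  induction s generalizing e with
  | zero => cases e <;> rfl
  | succ s ih =>
    rw [Function.iterate_succ_apply', SlyWCycle.edgeOf_rotate, ih]
    cases e <;> simp only [Sum.map_inl, Sum.map_inr, Function.iterate_succ_apply]

/-- **Any edge can be made the first edge by re-rooting/reflecting.** [folklore] -/
theorem SlyWCycle.exists_rep_edgeOf_zero (hj : 0 < j) (C : SlyWCycle n q j) (e₀ : Fin j ⊕ Fin j) :
    ∃ C' ∈ C.reps, C'.edgeOf (Sum.inl ⟨0, hj⟩) = C.edgeOf e₀ := by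
  have hiter : ∀ t : Fin j, (finRotate j)^[(t : ℕ)] (⟨0, hj⟩ : Fin j) = t := fun t =>
    Fin.ext (by rw [iterate_finRotate_val]; simp [Nat.mod_eq_of_lt t.isLt])
  rcases e₀ with t | t
  · refine ⟨SlyWCycle.rotate^[(t : ℕ)] C, SlyWCycle.mem_reps.2 ⟨t, false, rfl⟩, ?_⟩
    rw [SlyWCycle.edgeOf_iterate_rotate, Sum.map_inl, hiter]
  · refine ⟨SlyWCycle.rotate^[((Fin.rev t : Fin j) : ℕ)] C.reflect, SlyWCycle.mem_reps.2 ⟨Fin.rev t, true, rfl⟩, ?_⟩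
    rw [SlyWCycle.edgeOf_iterate_rotate, Sum.map_inl, hiter, SlyWCycle.edgeOf_reflect_inl, Fin.rev_rev]

/-- **Propagation** (general form): if every vertex of `C` has degree exactly two in an edge set `U`
containing `ES(C)` and `ES(D)`, and `C`, `D` share an edge, then `ES(C) ⊆ ES(D)` (for cycles of any two
lengths). [folklore] -/
theorem SlyWCycle.ES_subset_of_shared_edge (hj : 0 < j) {j' : ℕ} {C : SlyWCycle n q j} {D : SlyWCycle n q j'}
    {U : Finset (Option (Fin q) × Fin n × Fin n)} (hCU : C.ES ⊆ U) (hDU : D.ES ⊆ U)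
    (hdm : ∀ y ∈ univ.image C.w, (U.filter fun ε => ε.2.2 = y).card = 2)
    (hdp : ∀ x ∈ univ.image C.v, (U.filter fun ε => ε.2.1 = x).card = 2)
    {e₀ : Fin j ⊕ Fin j} (h : C.edgeOf e₀ ∈ D.ES) : C.ES ⊆ D.ES := by
  obtain ⟨j, rfl⟩ : ∃ j'', j = j'' + 1 := ⟨j - 1, by omega⟩
  obtain ⟨C', hC'reps, hC'0⟩ := SlyWCycle.exists_rep_edgeOf_zero hj C e₀
  have hC'ES : C'.ES = C.ES := SlyWCycle.ES_eq_of_mem_reps hC'reps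
  have hC'U : C'.ES ⊆ U := hC'ES ▸ hCU
  -- the vertices of `C'` are vertices of `C`
  have hw' : ∀ t, C'.w t ∈ univ.image C.w := by
    intro t
    have hmem : C'.edgeOf (Sum.inl t) ∈ C.ES := hC'ES ▸ C'.edgeOf_mem_ES _
    obtain ⟨e, he⟩ := SlyWCycle.mem_ES.1 hmem
    have := congrArg (fun ε : Option (Fin q) × Fin n × Fin n => ε.2.2) he
    simp only [SlyWCycle.edgeOf] at this
    have e2 : C'.w t = C.minusEnd e := this.symm
    rw [e2, SlyWCycle.minusEnd_eq]; exact Finset.mem_image_of_mem _ (Finset.mem_univ _)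
  have hv' : ∀ t, C'.v t ∈ univ.image C.v := by
    intro t
    have hmem : C'.edgeOf (Sum.inl t) ∈ C.ES := hC'ES ▸ C'.edgeOf_mem_ES _
    obtain ⟨e, he⟩ := SlyWCycle.mem_ES.1 hmem
    have := congrArg (fun ε : Option (Fin q) × Fin n × Fin n => ε.2.1) he
    simp only [SlyWCycle.edgeOf] at this
    have e2 : C'.v t = C.plusEnd e := this.symm
    rw [e2, SlyWCycle.plusEnd_eq]; exact Finset.mem_image_of_mem _ (Finset.mem_univ _)
  have key : ∀ t : ℕ, ∀ ht : t < j + 1,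
      C'.edgeOf (Sum.inl ⟨t, ht⟩) ∈ D.ES ∧ C'.edgeOf (Sum.inr ⟨t, ht⟩) ∈ D.ES := by
    intro t
    induction t with
    | zero =>
      intro ht
      have h0 : C'.edgeOf (Sum.inl 0) ∈ D.ES := by
        have e : (0 : Fin (j + 1)) = ⟨0, hj⟩ := rfl
        rw [e, hC'0]; exact h
      exact ⟨h0, SlyWCycle.inr_mem_of_inl_mem hC'U hDU 0 (hdm _ (hw' 0)) h0⟩
    | succ t ih =>
      intro ht
      have ih' := ih (by omega)
      have hfr : finRotate (j + 1) ⟨t, by omega⟩ = ⟨t + 1, ht⟩ := by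
        apply Fin.ext; rw [finRotate_val_eq]; exact Nat.mod_eq_of_lt ht
      have h1 := SlyWCycle.inl_mem_of_inr_mem hC'U hDU ⟨t, by omega⟩ (hdp _ (hv' _)) ih'.2
      rw [hfr] at h1
      exact ⟨h1, SlyWCycle.inr_mem_of_inl_mem hC'U hDU _ (hdm _ (hw' _)) h1⟩
  rw [← hC'ES]
  intro ε hε
  obtain ⟨e, rfl⟩ := SlyWCycle.mem_ES.1 hε
  rcases e with t | t
  · exact (key t t.isLt).1
  · exact (key t t.isLt).2

/-- **Propagation** inside a tuple: if every vertex of the union has degree exactly two and two member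
cycles share an edge, then the first is contained in (hence equal to) the second as a coloured edge
set. [folklore] -/
theorem ES_subset_of_shared_edge (hj : 0 < j) {m : ℕ} {f : Fin m → SlyWCycle n q j}
    (hdeg : (∀ x ∈ slyPlusVerts f, ((slyUnionES f).filter fun ε => ε.2.1 = x).card = 2) ∧
      ∀ y ∈ slyMinusVerts f, ((slyUnionES f).filter fun ε => ε.2.2 = y).card = 2)
    {k l : Fin m} {e₀ : Fin j ⊕ Fin j} (h : (f k).edgeOf e₀ ∈ (f l).ES) : (f k).ES ⊆ (f l).ES := by
  refine SlyWCycle.ES_subset_of_shared_edge hj (ES_subset_slyUnionES f k) (ES_subset_slyUnionES f l)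
    (fun y hy => hdeg.2 y ?_) (fun x hx => hdeg.1 x ?_) h
  · obtain ⟨t, -, rfl⟩ := Finset.mem_image.1 hy; exact w_mem_slyMinusVerts f k t
  · obtain ⟨t, -, rfl⟩ := Finset.mem_image.1 hx; exact v_mem_slyPlusVerts f k t

/-- At a plus vertex of degree two shared by two cycles (of any two lengths), they share an edge. [folklore] -/
theorem SlyWCycle.shared_edge_of_shared_plus {j' : ℕ} {C : SlyWCycle n q j} {D : SlyWCycle n q j'}
    {U : Finset (Option (Fin q) × Fin n × Fin n)} (hCU : C.ES ⊆ U) (hDU : D.ES ⊆ U) {t : Fin j} {t' : Fin j'}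
    (hF : (U.filter fun ε => ε.2.1 = C.v t).card = 2) (hvv : C.v t = D.v t') : D.edgeOf (Sum.inl t') ∈ C.ES := by
  have hPk : ({C.edgeOf (Sum.inl t), C.edgeOf (Sum.inr ((finRotate j).symm t))} : Finset _) ⊆ U.filter fun ε => ε.2.1 = C.v t := by
    intro ε hε; rw [Finset.mem_insert, Finset.mem_singleton] at hε; rw [Finset.mem_filter]
    rcases hε with rfl | rfl
    · exact ⟨hCU (C.edgeOf_mem_ES _), rfl⟩
    · refine ⟨hCU (C.edgeOf_mem_ES _), ?_⟩
      show C.v (finRotate j ((finRotate j).symm t)) = _; rw [Equiv.apply_symm_apply]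
  have hPl : ({D.edgeOf (Sum.inl t'), D.edgeOf (Sum.inr ((finRotate j').symm t'))} : Finset _) ⊆ U.filter fun ε => ε.2.1 = C.v t := by
    intro ε hε; rw [Finset.mem_insert, Finset.mem_singleton] at hε; rw [Finset.mem_filter]
    rcases hε with rfl | rfl
    · exact ⟨hDU (D.edgeOf_mem_ES _), hvv.symm⟩
    · refine ⟨hDU (D.edgeOf_mem_ES _), ?_⟩
      show D.v (finRotate j' ((finRotate j').symm t')) = _; rw [Equiv.apply_symm_apply, hvv]
  have heq := pair_eq_pair_of_subset hF (C.edgeOf_inl_ne_inr _ _) (D.edgeOf_inl_ne_inr _ _) hPk hPl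
  have : D.edgeOf (Sum.inl t') ∈ ({C.edgeOf (Sum.inl t), C.edgeOf (Sum.inr ((finRotate j).symm t))} : Finset _) := by
    rw [heq]; simp
  rw [Finset.mem_insert, Finset.mem_singleton] at this
  rcases this with h1 | h1 <;> rw [h1] <;> exact C.edgeOf_mem_ES _

/-- At a minus vertex of degree two shared by two cycles (of any two lengths), they share an edge. [folklore] -/
theorem SlyWCycle.shared_edge_of_shared_minus {j' : ℕ} {C : SlyWCycle n q j} {D : SlyWCycle n q j'}
    {U : Finset (Option (Fin q) × Fin n × Fin n)} (hCU : C.ES ⊆ U) (hDU : D.ES ⊆ U) {t : Fin j} {t' : Fin j'}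
    (hF : (U.filter fun ε => ε.2.2 = C.w t).card = 2) (hww : C.w t = D.w t') : D.edgeOf (Sum.inl t') ∈ C.ES := by
  have hPk : ({C.edgeOf (Sum.inl t), C.edgeOf (Sum.inr t)} : Finset _) ⊆ U.filter fun ε => ε.2.2 = C.w t := by
    intro ε hε; rw [Finset.mem_insert, Finset.mem_singleton] at hε; rw [Finset.mem_filter]
    rcases hε with rfl | rfl
    · exact ⟨hCU (C.edgeOf_mem_ES _), rfl⟩
    · exact ⟨hCU (C.edgeOf_mem_ES _), rfl⟩
  have hPl : ({D.edgeOf (Sum.inl t'), D.edgeOf (Sum.inr t')} : Finset _) ⊆ U.filter fun ε => ε.2.2 = C.w t := by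
    intro ε hε; rw [Finset.mem_insert, Finset.mem_singleton] at hε; rw [Finset.mem_filter]
    rcases hε with rfl | rfl
    · exact ⟨hDU (D.edgeOf_mem_ES _), hww.symm⟩
    · exact ⟨hDU (D.edgeOf_mem_ES _), hww.symm⟩
  have heq := pair_eq_pair_of_subset hF (C.edgeOf_inl_ne_inr _ _) (D.edgeOf_inl_ne_inr _ _) hPk hPl
  have : D.edgeOf (Sum.inl t') ∈ ({C.edgeOf (Sum.inl t), C.edgeOf (Sum.inr t)} : Finset _) := by
    rw [heq]; simp
  rw [Finset.mem_insert, Finset.mem_singleton] at this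
  rcases this with h1 | h1 <;> rw [h1] <;> exact C.edgeOf_mem_ES _

/-- At a plus vertex of degree two shared by two members, they share an edge. [folklore] -/
theorem shared_edge_of_shared_plus {m : ℕ} {f : Fin m → SlyWCycle n q j}
    (hdeg : ∀ x ∈ slyPlusVerts f, ((slyUnionES f).filter fun ε => ε.2.1 = x).card = 2)
    {k l : Fin m} {t t' : Fin j} (hvv : (f k).v t = (f l).v t') : (f l).edgeOf (Sum.inl t') ∈ (f k).ES :=
  SlyWCycle.shared_edge_of_shared_plus (ES_subset_slyUnionES f k) (ES_subset_slyUnionES f l) (hdeg _ (v_mem_slyPlusVerts f k t)) hvv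

/-- At a minus vertex of degree two shared by two members, they share an edge. [folklore] -/
theorem shared_edge_of_shared_minus {m : ℕ} {f : Fin m → SlyWCycle n q j}
    (hdeg : ∀ y ∈ slyMinusVerts f, ((slyUnionES f).filter fun ε => ε.2.2 = y).card = 2)
    {k l : Fin m} {t t' : Fin j} (hww : (f k).w t = (f l).w t') : (f l).edgeOf (Sum.inl t') ∈ (f k).ES :=
  SlyWCycle.shared_edge_of_shared_minus (ES_subset_slyUnionES f k) (ES_subset_slyUnionES f l) (hdeg _ (w_mem_slyMinusVerts f k t)) hww

/-- **Overlapping tuples with distinct underlying cycles have more edges than vertices**: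
`|U(f)| ≥ |V⁺(f)| + |V⁻(f)| + 1`. [cite: Sly2010, Lemma 3.7 (proof, after MWW09 Lemma 7.3: the overlapping configurations)] -/
theorem card_verts_lt_card_slyUnionES (hj : 0 < j) {m : ℕ} {f : Fin m → SlyWCycle n q j}
    (hdist : ∀ k l, k ≠ l → (f k).reps ≠ (f l).reps) (hnd : ¬SlyVertexDisjoint f) :
    (slyPlusVerts f).card + (slyMinusVerts f).card + 1 ≤ (slyUnionES f).card := by
  by_contra hlt
  have hle : (slyUnionES f).card ≤ (slyPlusVerts f).card + (slyMinusVerts f).card := by omega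
  have hdeg := degTwo_of_card_le f hle
  -- a shared vertex between two different members gives a shared edge
  have hshare : ∃ k l, k ≠ l ∧ ∃ e₀, (f l).edgeOf e₀ ∈ (f k).ES := by
    unfold SlyVertexDisjoint at hnd
    rw [not_and_or] at hnd
    rcases hnd with hnd | hnd
    · obtain ⟨⟨k, t⟩, ⟨l, t'⟩, hvv, hne⟩ : ∃ p p' : Fin m × Fin j, (f p.1).v p.2 = (f p'.1).v p'.2 ∧ p ≠ p' := by
        by_contra hall
        apply hnd
        intro p p' h
        by_contra hne
        exact hall ⟨p, p', h, hne⟩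
      simp only at hvv
      have hkl : k ≠ l := by
        rintro rfl
        exact hne (Prod.ext rfl ((f k).hv hvv))
      exact ⟨k, l, hkl, Sum.inl t', shared_edge_of_shared_plus hdeg.1 hvv⟩
    · obtain ⟨⟨k, t⟩, ⟨l, t'⟩, hww, hne⟩ : ∃ p p' : Fin m × Fin j, (f p.1).w p.2 = (f p'.1).w p'.2 ∧ p ≠ p' := by
        by_contra hall
        apply hnd
        intro p p' h
        by_contra hne
        exact hall ⟨p, p', h, hne⟩
      simp only at hww
      have hkl : k ≠ l := by
        rintro rfl
        exact hne (Prod.ext rfl ((f k).hw hww))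
      exact ⟨k, l, hkl, Sum.inl t', shared_edge_of_shared_minus hdeg.2 hww⟩
  obtain ⟨k, l, hkl, e₀, he₀⟩ := hshare
  have hsub := ES_subset_of_shared_edge hj hdeg he₀
  have heqES : (f l).ES = (f k).ES := Finset.eq_of_subset_of_card_le hsub (by rw [SlyWCycle.card_ES, SlyWCycle.card_ES])
  have hmem : f l ∈ (f k).reps := SlyWCycle.mem_reps_of_ES_eq hj heqES
  exact hdist l k hkl.symm (SlyWCycle.reps_eq_of_mem_reps hj hmem)

end Propagation

section UnionPresence

variable {n m' q j : ℕ}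

/-- Presence of a single coloured edge `(c, plus, minus)`. [folklore] -/
def SlyTriplePresent (σ : Fin q → Equiv.Perm (Fin (n + m'))) (τ : Equiv.Perm (Fin n)) (ε : Option (Fin q) × Fin n × Fin n) : Prop :=
  SlyEdgePresent σ τ ε.1 ε.2.1 ε.2.2

/-- A cycle is present iff all its coloured edges are. [folklore] -/
theorem SlyWCycle.present_iff_ES (C : SlyWCycle n q j) (σ : Fin q → Equiv.Perm (Fin (n + m'))) (τ : Equiv.Perm (Fin n)) :
    C.Present σ τ ↔ ∀ ε ∈ C.ES, SlyTriplePresent σ τ ε := by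
  constructor
  · rintro ⟨h1, h2⟩ ε hε
    obtain ⟨e, rfl⟩ := SlyWCycle.mem_ES.1 hε
    rcases e with t | t
    · exact h1 t
    · exact h2 t
  · intro h
    exact ⟨fun t => h _ (C.edgeOf_mem_ES (Sum.inl t)), fun t => h _ (C.edgeOf_mem_ES (Sum.inr t))⟩

/-- A tuple is present iff all edges of the union are. [folklore] -/
theorem present_tuple_iff_union {m : ℕ} (f : Fin m → SlyWCycle n q j) (σ : Fin q → Equiv.Perm (Fin (n + m'))) (τ : Equiv.Perm (Fin n)) :
    (∀ k, (f k).Present σ τ) ↔ ∀ ε ∈ slyUnionES f, SlyTriplePresent σ τ ε := by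
  simp only [SlyWCycle.present_iff_ES, slyUnionES, Finset.mem_biUnion, Finset.mem_univ, true_and]
  exact ⟨fun h ε ⟨k, hk⟩ => h k ε hk, fun h k ε hε => h ε ⟨k, hε⟩⟩

/-- The colour class `c` of the union. [folklore] -/
noncomputable def slyUnionClass {m : ℕ} (f : Fin m → SlyWCycle n q j) (c : Option (Fin q)) : Finset (Option (Fin q) × Fin n × Fin n) :=
  (slyUnionES f).filter fun ε => ε.1 = c

/-- The colour classes partition the union: `Σ_c |U_c| = |U|`. [folklore] -/
theorem sum_card_slyUnionClass {m : ℕ} (f : Fin m → SlyWCycle n q j) :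
    ∑ c : Option (Fin q), (slyUnionClass f c).card = (slyUnionES f).card := by
  unfold slyUnionClass
  rw [← Finset.card_eq_sum_card_fiberwise (t := (univ : Finset (Option (Fin q)))) (f := fun ε : Option (Fin q) × Fin n × Fin n => ε.1)
    (fun _ _ => Finset.mem_coe.2 (Finset.mem_univ _))]

open scoped Classical in
/-- **Probability of a coloured edge set** (Sly's `P1` for unions): if the realisations containing
all edges of `U(f)` exist at all, the colour classes are partial matchings and their number is
`Π_c (n+m' - |U_c|)! (n - |U_τ|)!`; in all cases `#{ω ⊇ U(f)} · (n - 2mj)^{|U(f)|} ≤ N_tot`.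
[cite: Sly2010, Lemma 3.7 (proof)] -/
theorem card_present_tuple_mul_pow_le {m : ℕ} (f : Fin m → SlyWCycle n q j) (hn : 2 * (m * j) < n) :
    (Fintype.card {ω : (Fin q → Equiv.Perm (Fin (n + m'))) × Equiv.Perm (Fin n) // ∀ k, (f k).Present ω.1 ω.2} : ℝ) *
        ((n : ℝ) - 2 * (m * j : ℕ)) ^ (slyUnionES f).card ≤
      (((n + m').factorial : ℝ) ^ q) * (n.factorial : ℝ) := by
  classical
  have hNtot : (0 : ℝ) < (((n + m').factorial : ℝ) ^ q) * (n.factorial : ℝ) := by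
    have h1 : (0 : ℝ) < (n + m').factorial := by exact_mod_cast Nat.factorial_pos _
    have h2 : (0 : ℝ) < n.factorial := by exact_mod_cast Nat.factorial_pos _
    positivity
  by_cases hempty : IsEmpty {ω : (Fin q → Equiv.Perm (Fin (n + m'))) × Equiv.Perm (Fin n) // ∀ k, (f k).Present ω.1 ω.2}
  · rw [Fintype.card_eq_zero]; simp [hNtot.le]
  rw [not_isEmpty_iff] at hempty
  obtain ⟨⟨ω₀, hω₀⟩⟩ := hempty
  have hω₀' := (present_tuple_iff_union f ω₀.1 ω₀.2).1 hω₀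
  -- the colour classes are partial matchings
  have hP : ∀ c, Set.InjOn (fun ε : Option (Fin q) × Fin n × Fin n => ε.2.1) ((slyUnionES f).filter fun ε => ε.1 = c) := by
    intro c ε hε ε' hε' h
    obtain ⟨c₁, p₁, m₁⟩ := ε
    obtain ⟨c₂, p₂, m₂⟩ := ε'
    simp only [Finset.coe_filter, Set.mem_setOf_eq] at hε hε' h
    obtain ⟨hU1, rfl⟩ := hε
    obtain ⟨hU2, hc2⟩ := hε'
    subst hc2; subst h
    have h1 := hω₀' _ hU1
    have h2 := hω₀' _ hU2
    unfold SlyTriplePresent SlyEdgePresent at h1 h2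
    cases c₂ with
    | none =>
      simp only at h1 h2
      rw [h1] at h2; rw [h2]
    | some c =>
      simp only at h1 h2
      rw [h1] at h2; rw [Fin.castAdd_injective _ _ h2]
  have hM : ∀ c, Set.InjOn (fun ε : Option (Fin q) × Fin n × Fin n => ε.2.2) ((slyUnionES f).filter fun ε => ε.1 = c) := by
    intro c ε hε ε' hε' h
    obtain ⟨c₁, p₁, m₁⟩ := ε
    obtain ⟨c₂, p₂, m₂⟩ := ε'
    simp only [Finset.coe_filter, Set.mem_setOf_eq] at hε hε' h
    obtain ⟨hU1, rfl⟩ := hε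
    obtain ⟨hU2, hc2⟩ := hε'
    subst hc2; subst h
    have h1 := hω₀' _ hU1
    have h2 := hω₀' _ hU2
    unfold SlyTriplePresent SlyEdgePresent at h1 h2
    cases c₂ with
    | none =>
      simp only at h1 h2
      rw [← h2] at h1; rw [ω₀.2.injective h1]
    | some c =>
      simp only at h1 h2
      rw [← h2] at h1; rw [Fin.castAdd_injective _ _ ((ω₀.1 c).injective h1)]
  have hcard := card_realisations_with_edges (n := n) (m' := m') (q := q) (slyUnionES f)
    (fun ε => ε.1) (fun ε => ε.2.1) (fun ε => ε.2.2) hP hM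
  -- identify the predicate
  have hpres : ∀ ω : (Fin q → Equiv.Perm (Fin (n + m'))) × Equiv.Perm (Fin n),
      (∀ k, (f k).Present ω.1 ω.2) ↔
        ((∀ c : Fin q, ∀ ε ∈ (slyUnionES f).filter (fun ε => ε.1 = some c), ω.1 c (Fin.castAdd m' ε.2.1) = Fin.castAdd m' ε.2.2) ∧
          ∀ ε ∈ (slyUnionES f).filter (fun ε => ε.1 = none), ω.2 ε.2.1 = ε.2.2) := by
    intro ω
    rw [present_tuple_iff_union]
    simp only [Finset.mem_filter]
    constructor
    · intro h
      refine ⟨fun c ε hε => ?_, fun ε hε => ?_⟩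
      · have := h ε hε.1; unfold SlyTriplePresent SlyEdgePresent at this; rw [hε.2] at this; exact this
      · have := h ε hε.1; unfold SlyTriplePresent SlyEdgePresent at this; rw [hε.2] at this; exact this
    · rintro ⟨h1, h2⟩ ε hε
      unfold SlyTriplePresent SlyEdgePresent
      obtain ⟨c, p, mi⟩ := ε
      cases c with
      | none => exact h2 _ ⟨hε, rfl⟩
      | some c => exact h1 c _ ⟨hε, rfl⟩
  rw [Fintype.card_subtype] at hcard ⊢
  rw [Finset.filter_congr (fun ω _ => hpres ω), hcard]
  have hmj : ((m * j : ℕ) : ℝ) = (m : ℝ) * (j : ℝ) := by push_cast; ring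
  rw [hmj]
  -- the factorial bound
  have hUle : (slyUnionES f).card ≤ 2 * (m * j) := card_slyUnionES_le f
  have hcls : ∀ c, ((slyUnionES f).filter fun ε => ε.1 = c).card ≤ (slyUnionES f).card := fun c => Finset.card_filter_le _ _
  have hfac : ∀ (N k : ℕ), n ≤ N → k ≤ (slyUnionES f).card →
      (((N - k).factorial : ℕ) : ℝ) * ((n : ℝ) - 2 * ((m : ℝ) * (j : ℝ))) ^ k ≤ (N.factorial : ℝ) := by
    intro N k hNn hk
    have hkN : k ≤ N := by omega
    have h1 : ((n : ℝ) - 2 * ((m : ℝ) * (j : ℝ))) ^ k ≤ (N.descFactorial k : ℝ) := by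
      have h := Nat.pow_sub_le_descFactorial N k
      have h' : (((N + 1 - k : ℕ) : ℝ)) ^ k ≤ (N.descFactorial k : ℝ) := by exact_mod_cast h
      refine le_trans (pow_le_pow_left₀ ?_ ?_ k) h'
      · have : ((2 * (m * j) : ℕ) : ℝ) < n := by exact_mod_cast hn
        push_cast at this ⊢; linarith
      · rw [Nat.cast_sub (by omega : k ≤ N + 1)]; push_cast
        have : (k : ℝ) ≤ 2 * ((m : ℝ) * (j : ℝ)) := by exact_mod_cast (hk.trans hUle)
        have : (n : ℝ) ≤ N := by exact_mod_cast hNn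
        push_cast at *; linarith
    calc (((N - k).factorial : ℕ) : ℝ) * ((n : ℝ) - 2 * ((m : ℝ) * (j : ℝ))) ^ k ≤ ((N - k).factorial : ℝ) * (N.descFactorial k : ℝ) :=
          mul_le_mul_of_nonneg_left h1 (Nat.cast_nonneg _)
      _ = (N.factorial : ℝ) := by exact_mod_cast factorial_sub_mul_descFactorial hkN
  -- split the power of `(n - 2mj)` along the colour classes
  have hsplit : ((n : ℝ) - 2 * ((m : ℝ) * (j : ℝ))) ^ (slyUnionES f).card =
      (∏ c : Fin q, ((n : ℝ) - 2 * ((m : ℝ) * (j : ℝ))) ^ ((slyUnionES f).filter fun ε => ε.1 = some c).card) *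
        ((n : ℝ) - 2 * ((m : ℝ) * (j : ℝ))) ^ ((slyUnionES f).filter fun ε => ε.1 = none).card := by
    rw [Finset.prod_pow_eq_pow_sum, ← pow_add, ← sum_card_slyUnionClass f, Fintype.sum_option]
    unfold slyUnionClass; ring_nf
  rw [hsplit]
  simp only [Nat.cast_mul, Nat.cast_prod]
  calc (∏ c : Fin q, (((n + m' - ((slyUnionES f).filter fun ε => ε.1 = some c).card).factorial : ℕ) : ℝ)) *
        (((n - ((slyUnionES f).filter fun ε => ε.1 = none).card).factorial : ℕ) : ℝ) *
        ((∏ c : Fin q, ((n : ℝ) - 2 * ((m : ℝ) * (j : ℝ))) ^ ((slyUnionES f).filter fun ε => ε.1 = some c).card) *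
          ((n : ℝ) - 2 * ((m : ℝ) * (j : ℝ))) ^ ((slyUnionES f).filter fun ε => ε.1 = none).card)
      = (∏ c : Fin q, (((n + m' - ((slyUnionES f).filter fun ε => ε.1 = some c).card).factorial : ℕ) : ℝ) *
          ((n : ℝ) - 2 * ((m : ℝ) * (j : ℝ))) ^ ((slyUnionES f).filter fun ε => ε.1 = some c).card) *
        ((((n - ((slyUnionES f).filter fun ε => ε.1 = none).card).factorial : ℕ) : ℝ) *
          ((n : ℝ) - 2 * ((m : ℝ) * (j : ℝ))) ^ ((slyUnionES f).filter fun ε => ε.1 = none).card) := by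
        rw [Finset.prod_mul_distrib]; ring
    _ ≤ (∏ _c : Fin q, ((n + m').factorial : ℝ)) * (n.factorial : ℝ) := by
        have hnn : (0 : ℝ) ≤ (n : ℝ) - 2 * ((m : ℝ) * (j : ℝ)) := by
          have : ((2 * (m * j) : ℕ) : ℝ) < n := by exact_mod_cast hn
          push_cast at this ⊢; linarith
        refine mul_le_mul (Finset.prod_le_prod (fun c _ => mul_nonneg (Nat.cast_nonneg _) (pow_nonneg hnn _))
          fun c _ => hfac _ _ (Nat.le_add_right n m') (hcls _)) (hfac _ _ le_rfl (hcls _))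
          (mul_nonneg (Nat.cast_nonneg _) (pow_nonneg hnn _)) (Finset.prod_nonneg fun c _ => Nat.cast_nonneg _)
    _ = (((n + m').factorial : ℝ) ^ q) * (n.factorial : ℝ) := by rw [Finset.prod_const, Finset.card_univ, Fintype.card_fin]

end UnionPresence

section TupleCounting

variable {n q j : ℕ}

open scoped Classical in
/-- **Tuples supported on prescribed vertex sets**: at most `(|A|^j |B|^j (q+1)^{2j})^m` of them. [folklore] -/
theorem card_tuples_subset_le {m : ℕ} (A B : Finset (Fin n)) :
    ((univ : Finset (Fin m → SlyWCycle n q j)).filter fun f => slyPlusVerts f ⊆ A ∧ slyMinusVerts f ⊆ B).card ≤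
      (A.card ^ j * B.card ^ j * ((q + 1) ^ j * (q + 1) ^ j)) ^ m := by
  -- inject into `Fin m → (A^j × B^j × colours × colours)`
  let T : Finset ((Fin j → Fin n) × (Fin j → Fin n) × (Fin j → Option (Fin q)) × (Fin j → Option (Fin q))) :=
    (Fintype.piFinset fun _ : Fin j => A) ×ˢ ((Fintype.piFinset fun _ : Fin j => B) ×ˢ (univ ×ˢ univ))
  let g : (Fin m → SlyWCycle n q j) → (Fin m → (Fin j → Fin n) × (Fin j → Fin n) × (Fin j → Option (Fin q)) × (Fin j → Option (Fin q))) :=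
    fun f k => ((f k).v, (f k).w, (f k).a, (f k).b)
  have hmaps : ∀ f ∈ (univ : Finset (Fin m → SlyWCycle n q j)).filter (fun f => slyPlusVerts f ⊆ A ∧ slyMinusVerts f ⊆ B),
      g f ∈ Fintype.piFinset fun _ : Fin m => T := by
    intro f hf
    rw [Finset.mem_filter] at hf
    rw [Fintype.mem_piFinset]
    intro k
    simp only [T, Finset.mem_product, Fintype.mem_piFinset, Finset.mem_univ, and_true, g]
    exact ⟨fun t => hf.2.1 (v_mem_slyPlusVerts f k t), fun t => hf.2.2 (w_mem_slyMinusVerts f k t)⟩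
  have hinj : Set.InjOn g ((univ : Finset (Fin m → SlyWCycle n q j)).filter (fun f => slyPlusVerts f ⊆ A ∧ slyMinusVerts f ⊆ B)) := by
    intro f _ f' _ h
    funext k
    have hk := congrFun h k
    simp only [g, Prod.mk.injEq] at hk
    exact SlyWCycle.ext' hk.1 hk.2.1 hk.2.2.1 hk.2.2.2
  refine (Finset.card_le_card_of_injOn g hmaps hinj).trans ?_
  rw [Fintype.card_piFinset_const]
  apply Nat.pow_le_pow_left
  simp only [T, Finset.card_product, Fintype.card_piFinset_const, Finset.card_univ, Fintype.card_fun, Fintype.card_fin,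
    Fintype.card_option]
  exact le_of_eq (by ring)

open scoped Classical in
/-- **Counting tuples by their vertex counts**: at most `C(n,a) C(n,b) (a^j b^j (q+1)^{2j})^m` tuples have
`|V⁺| = a` and `|V⁻| = b`. [cite: Sly2010, Lemma 3.7 (proof: "standard methods")] -/
theorem card_tuples_verts_le {m : ℕ} (a b : ℕ) :
    ((univ : Finset (Fin m → SlyWCycle n q j)).filter fun f => (slyPlusVerts f).card = a ∧ (slyMinusVerts f).card = b).card ≤
      n.choose a * n.choose b * (a ^ j * b ^ j * ((q + 1) ^ j * (q + 1) ^ j)) ^ m := by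
  set S := (univ : Finset (Fin m → SlyWCycle n q j)).filter fun f => (slyPlusVerts f).card = a ∧ (slyMinusVerts f).card = b
  have hmaps : (S : Set (Fin m → SlyWCycle n q j)).MapsTo (fun f => (slyPlusVerts f, slyMinusVerts f))
      (((Finset.powersetCard a (univ : Finset (Fin n))) ×ˢ (Finset.powersetCard b (univ : Finset (Fin n))) :
        Finset (Finset (Fin n) × Finset (Fin n))) : Set (Finset (Fin n) × Finset (Fin n))) := by
    intro f hf
    have hf' := (Finset.mem_filter.1 (Finset.mem_coe.1 hf)).2
    rw [Finset.mem_coe, Finset.mem_product, Finset.mem_powersetCard, Finset.mem_powersetCard]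
    exact ⟨⟨Finset.subset_univ _, hf'.1⟩, ⟨Finset.subset_univ _, hf'.2⟩⟩
  rw [Finset.card_eq_sum_card_fiberwise hmaps]
  calc ∑ AB ∈ (Finset.powersetCard a (univ : Finset (Fin n))) ×ˢ (Finset.powersetCard b (univ : Finset (Fin n))),
        (S.filter fun f => (slyPlusVerts f, slyMinusVerts f) = AB).card
      ≤ ∑ AB ∈ (Finset.powersetCard a (univ : Finset (Fin n))) ×ˢ (Finset.powersetCard b (univ : Finset (Fin n))),
          (AB.1.card ^ j * AB.2.card ^ j * ((q + 1) ^ j * (q + 1) ^ j)) ^ m := by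
        refine Finset.sum_le_sum fun AB _ => le_trans (Finset.card_le_card ?_) (card_tuples_subset_le AB.1 AB.2)
        intro f hf
        rw [Finset.mem_filter] at hf ⊢
        obtain ⟨-, h⟩ := hf
        refine ⟨Finset.mem_univ _, ?_, ?_⟩
        · rw [← (Prod.mk.inj h).1]
        · rw [← (Prod.mk.inj h).2]
    _ = ∑ AB ∈ (Finset.powersetCard a (univ : Finset (Fin n))) ×ˢ (Finset.powersetCard b (univ : Finset (Fin n))),
          (a ^ j * b ^ j * ((q + 1) ^ j * (q + 1) ^ j)) ^ m := by
        refine Finset.sum_congr rfl fun AB hAB => ?_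
        rw [Finset.mem_product, Finset.mem_powersetCard, Finset.mem_powersetCard] at hAB
        rw [hAB.1.2, hAB.2.2]
    _ = n.choose a * n.choose b * (a ^ j * b ^ j * ((q + 1) ^ j * (q + 1) ^ j)) ^ m := by
        rw [Finset.sum_const, Finset.card_product, Finset.card_powersetCard, Finset.card_powersetCard, Finset.card_univ,
          Fintype.card_fin, smul_eq_mul]

end TupleCounting

section OverlapBound

variable {n m' q j : ℕ}

open scoped Classical in
/-- **The overlapping tuples contribute `O(1/n)`**: with `x = n - 2mj > 0` and
`K = ((mj)^{2j} (q+1)^{2j})^m`,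
`Σ_{f overlapping, distinct reps} #{ω ⊇ ⋃ f} ≤ N_tot · (mj+1)² K (n/x)^{2mj} / x`.
[cite: Sly2010, Lemma 3.7 (proof: overlapping configurations, after MWW09 Lemma 7.3)] -/
theorem sum_overlap_le (hj : 0 < j) (m : ℕ) (hn : 2 * (m * j) < n) :
    (∑ f : Fin m → SlyWCycle n q j, if (∀ k l, k ≠ l → (f k).reps ≠ (f l).reps) ∧ ¬SlyVertexDisjoint f then
        (Fintype.card {ω : (Fin q → Equiv.Perm (Fin (n + m'))) × Equiv.Perm (Fin n) // ∀ k, (f k).Present ω.1 ω.2} : ℝ) else 0) ≤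
      ((((n + m').factorial : ℝ) ^ q) * (n.factorial : ℝ)) *
        ((((m * j + 1) ^ 2 : ℕ) : ℝ) * ((((m * j) ^ j * (m * j) ^ j * ((q + 1) ^ j * (q + 1) ^ j)) ^ m : ℕ) : ℝ) *
          (((n : ℝ) / ((n : ℝ) - 2 * (m * j : ℕ))) ^ (2 * (m * j)) / ((n : ℝ) - 2 * (m * j : ℕ)))) := by
  set Ntot : ℝ := (((n + m').factorial : ℝ) ^ q) * (n.factorial : ℝ) with hNtot
  set x : ℝ := (n : ℝ) - 2 * (m * j : ℕ) with hx
  have hNtot0 : 0 < Ntot := by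
    have h1 : (0 : ℝ) < (n + m').factorial := by exact_mod_cast Nat.factorial_pos _
    have h2 : (0 : ℝ) < n.factorial := by exact_mod_cast Nat.factorial_pos _
    rw [hNtot]; positivity
  have hx1 : 1 ≤ x := by
    have : ((2 * (m * j) + 1 : ℕ) : ℝ) ≤ n := by exact_mod_cast hn
    rw [hx]; push_cast at this ⊢; linarith
  have hx0 : 0 < x := by linarith
  have hnx : 1 ≤ (n : ℝ) / x := by
    rw [le_div_iff₀ hx0, hx]; have : (0 : ℝ) ≤ (m * j : ℕ) := Nat.cast_nonneg _; linarith
  set K : ℝ := ((((m * j) ^ j * (m * j) ^ j * ((q + 1) ^ j * (q + 1) ^ j)) ^ m : ℕ) : ℝ) with hK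
  have hK0 : 0 ≤ K := Nat.cast_nonneg _
  -- Step 1: each overlapping term is at most `Ntot / x^{v(f)+1}`
  have hterm : ∀ f : Fin m → SlyWCycle n q j,
      (if (∀ k l, k ≠ l → (f k).reps ≠ (f l).reps) ∧ ¬SlyVertexDisjoint f then
        (Fintype.card {ω : (Fin q → Equiv.Perm (Fin (n + m'))) × Equiv.Perm (Fin n) // ∀ k, (f k).Present ω.1 ω.2} : ℝ) else 0) ≤
      Ntot / x ^ ((slyPlusVerts f).card + (slyMinusVerts f).card + 1) := by
    intro f
    split_ifs with h
    · have h1 := card_present_tuple_mul_pow_le (m' := m') f hn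
      rw [← hx, ← hNtot] at h1
      have h2 := card_verts_lt_card_slyUnionES hj h.1 h.2
      rw [le_div_iff₀ (pow_pos hx0 _)]
      calc (Fintype.card {ω : (Fin q → Equiv.Perm (Fin (n + m'))) × Equiv.Perm (Fin n) // ∀ k, (f k).Present ω.1 ω.2} : ℝ) *
            x ^ ((slyPlusVerts f).card + (slyMinusVerts f).card + 1)
          ≤ (Fintype.card {ω : (Fin q → Equiv.Perm (Fin (n + m'))) × Equiv.Perm (Fin n) // ∀ k, (f k).Present ω.1 ω.2} : ℝ) *
            x ^ (slyUnionES f).card := mul_le_mul_of_nonneg_left (pow_le_pow_right₀ hx1 h2) (Nat.cast_nonneg _)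
        _ ≤ Ntot := h1
    · exact div_nonneg hNtot0.le (pow_nonneg hx0.le _)
  -- Step 2: sum over all tuples, fibre by the vertex counts
  have hfib : (∑ f : Fin m → SlyWCycle n q j, Ntot / x ^ ((slyPlusVerts f).card + (slyMinusVerts f).card + 1)) =
      ∑ ab ∈ (Finset.range (m * j + 1)) ×ˢ (Finset.range (m * j + 1)),
        (((univ : Finset (Fin m → SlyWCycle n q j)).filter fun f => (slyPlusVerts f).card = ab.1 ∧ (slyMinusVerts f).card = ab.2).card : ℝ) *
          (Ntot / x ^ (ab.1 + ab.2 + 1)) := by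
    rw [← Finset.sum_fiberwise_of_maps_to (s := (univ : Finset (Fin m → SlyWCycle n q j)))
      (t := (Finset.range (m * j + 1)) ×ˢ (Finset.range (m * j + 1)))
      (g := fun f => ((slyPlusVerts f).card, (slyMinusVerts f).card))
      (fun f _ => Finset.mem_product.2 ⟨Finset.mem_range.2 (Nat.lt_succ_of_le (card_slyPlusVerts_le f)),
        Finset.mem_range.2 (Nat.lt_succ_of_le (card_slyMinusVerts_le f))⟩)]
    refine Finset.sum_congr rfl fun ab _ => ?_
    rw [Finset.sum_congr rfl (fun f hf => by
        have h := (Finset.mem_filter.1 hf).2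
        rw [← (Prod.mk.inj h).1, ← (Prod.mk.inj h).2]
        : ∀ f ∈ univ.filter (fun f : Fin m → SlyWCycle n q j => ((slyPlusVerts f).card, (slyMinusVerts f).card) = ab),
          Ntot / x ^ ((slyPlusVerts f).card + (slyMinusVerts f).card + 1) = Ntot / x ^ (ab.1 + ab.2 + 1)),
      Finset.sum_const, nsmul_eq_mul]
    have hfeq : (univ.filter fun f : Fin m → SlyWCycle n q j => ((slyPlusVerts f).card, (slyMinusVerts f).card) = ab) =
        univ.filter fun f => (slyPlusVerts f).card = ab.1 ∧ (slyMinusVerts f).card = ab.2 := by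
      ext f; simp [Prod.ext_iff]
    rw [hfeq]
  -- Step 3: bound each fibre
  have hab : ∀ ab ∈ (Finset.range (m * j + 1)) ×ˢ (Finset.range (m * j + 1)),
      (((univ : Finset (Fin m → SlyWCycle n q j)).filter fun f => (slyPlusVerts f).card = ab.1 ∧ (slyMinusVerts f).card = ab.2).card : ℝ) *
          (Ntot / x ^ (ab.1 + ab.2 + 1)) ≤ Ntot * (K * (((n : ℝ) / x) ^ (2 * (m * j)) / x)) := by
    intro ab hab
    rw [Finset.mem_product, Finset.mem_range, Finset.mem_range] at hab
    obtain ⟨ha, hb⟩ := hab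
    have hcount : (((univ : Finset (Fin m → SlyWCycle n q j)).filter fun f => (slyPlusVerts f).card = ab.1 ∧ (slyMinusVerts f).card = ab.2).card : ℝ) ≤
        (n : ℝ) ^ (ab.1 + ab.2) * K := by
      have h := card_tuples_verts_le (n := n) (q := q) (j := j) (m := m) ab.1 ab.2
      have h' : ((n.choose ab.1 * n.choose ab.2 * (ab.1 ^ j * ab.2 ^ j * ((q + 1) ^ j * (q + 1) ^ j)) ^ m : ℕ) : ℝ) ≤
          (n : ℝ) ^ (ab.1 + ab.2) * K := by
        have h1 : n.choose ab.1 ≤ n ^ ab.1 := Nat.choose_le_pow n ab.1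
        have h2 : n.choose ab.2 ≤ n ^ ab.2 := Nat.choose_le_pow n ab.2
        have h3 : (ab.1 ^ j * ab.2 ^ j * ((q + 1) ^ j * (q + 1) ^ j)) ^ m ≤ ((m * j) ^ j * (m * j) ^ j * ((q + 1) ^ j * (q + 1) ^ j)) ^ m :=
          Nat.pow_le_pow_left (Nat.mul_le_mul (Nat.mul_le_mul (Nat.pow_le_pow_left (by omega) _) (Nat.pow_le_pow_left (by omega) _)) le_rfl) _
        have h4 : n.choose ab.1 * n.choose ab.2 * (ab.1 ^ j * ab.2 ^ j * ((q + 1) ^ j * (q + 1) ^ j)) ^ m ≤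
            n ^ ab.1 * n ^ ab.2 * ((m * j) ^ j * (m * j) ^ j * ((q + 1) ^ j * (q + 1) ^ j)) ^ m :=
          Nat.mul_le_mul (Nat.mul_le_mul h1 h2) h3
        have h5 : ((n.choose ab.1 * n.choose ab.2 * (ab.1 ^ j * ab.2 ^ j * ((q + 1) ^ j * (q + 1) ^ j)) ^ m : ℕ) : ℝ) ≤
            ((n ^ ab.1 * n ^ ab.2 * ((m * j) ^ j * (m * j) ^ j * ((q + 1) ^ j * (q + 1) ^ j)) ^ m : ℕ) : ℝ) := by exact_mod_cast h4
        refine h5.trans (le_of_eq ?_)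
        rw [hK]; push_cast; ring
      exact le_trans (by exact_mod_cast h) h'
    have hpow : (n : ℝ) ^ (ab.1 + ab.2) / x ^ (ab.1 + ab.2 + 1) ≤ ((n : ℝ) / x) ^ (2 * (m * j)) / x := by
      rw [pow_succ, ← div_div, ← div_pow]
      exact div_le_div_of_nonneg_right (pow_le_pow_right₀ hnx (by omega)) hx0.le
    calc (((univ : Finset (Fin m → SlyWCycle n q j)).filter fun f => (slyPlusVerts f).card = ab.1 ∧ (slyMinusVerts f).card = ab.2).card : ℝ) *
          (Ntot / x ^ (ab.1 + ab.2 + 1))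
        ≤ ((n : ℝ) ^ (ab.1 + ab.2) * K) * (Ntot / x ^ (ab.1 + ab.2 + 1)) :=
          mul_le_mul_of_nonneg_right hcount (div_nonneg hNtot0.le (pow_nonneg hx0.le _))
      _ = Ntot * (K * ((n : ℝ) ^ (ab.1 + ab.2) / x ^ (ab.1 + ab.2 + 1))) := by ring
      _ ≤ Ntot * (K * (((n : ℝ) / x) ^ (2 * (m * j)) / x)) :=
          mul_le_mul_of_nonneg_left (mul_le_mul_of_nonneg_left hpow hK0) hNtot0.le
  -- Step 4: add up
  calc _ ≤ ∑ f : Fin m → SlyWCycle n q j, Ntot / x ^ ((slyPlusVerts f).card + (slyMinusVerts f).card + 1) :=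
        Finset.sum_le_sum fun f _ => hterm f
    _ = _ := hfib
    _ ≤ ∑ _ab ∈ (Finset.range (m * j + 1)) ×ˢ (Finset.range (m * j + 1)), Ntot * (K * (((n : ℝ) / x) ^ (2 * (m * j)) / x)) :=
        Finset.sum_le_sum hab
    _ = Ntot * ((((m * j + 1) ^ 2 : ℕ) : ℝ) * K * (((n : ℝ) / x) ^ (2 * (m * j)) / x)) := by
        rw [Finset.sum_const, Finset.card_product, Finset.card_range, nsmul_eq_mul]; push_cast; ring

end OverlapBound

section UpperBound

variable {n m' q j : ℕ}

open scoped Classical in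
/-- **Upper bound on the factorial moments of the cycle counts** (Sly's Lemma 3.7, upper half, all `n`):
`E[(2j)^m (X_{2j})_m] ≤ (q^{2j}+q)^m (n/(n-2mj))^{2mj} + (mj+1)² ((mj)^{2j}(q+1)^{2j})^m (n/(n-2mj))^{2mj}/(n-2mj)`.
Together with `avg_slyDistinctTuples_ge` this gives `E[(2j)^m (X_{2j})_m] → (q^{2j}+q)^m` whenever
`m, j` are fixed (or grow slowly) and `m' = o(n)`. [cite: Sly2010, Lemma 3.7] -/
theorem avg_slyDistinctTuples_le (hj : 1 ≤ j) (m : ℕ) (hn : 2 * (m * j) < n) :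
    (∑ ω : (Fin q → Equiv.Perm (Fin (n + m'))) × Equiv.Perm (Fin n), (slyDistinctTuples n m' q j m ω.1 ω.2 : ℝ)) /
        ((((n + m').factorial : ℝ) ^ q) * (n.factorial : ℝ)) ≤
      ((q : ℝ) ^ (2 * j) + q) ^ m * ((n : ℝ) / ((n : ℝ) - 2 * (m * j : ℕ))) ^ (2 * (m * j)) +
        (((m * j + 1) ^ 2 : ℕ) : ℝ) * ((((m * j) ^ j * (m * j) ^ j * ((q + 1) ^ j * (q + 1) ^ j)) ^ m : ℕ) : ℝ) *
          (((n : ℝ) / ((n : ℝ) - 2 * (m * j : ℕ))) ^ (2 * (m * j)) / ((n : ℝ) - 2 * (m * j : ℕ))) := by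
  have hN : (0 : ℝ) < (((n + m').factorial : ℝ) ^ q) * (n.factorial : ℝ) := by
    have h1 : (0 : ℝ) < (n + m').factorial := by exact_mod_cast Nat.factorial_pos _
    have h2 : (0 : ℝ) < n.factorial := by exact_mod_cast Nat.factorial_pos _
    positivity
  have hj0 : 0 < j := hj
  -- the exact double count, split into disjoint and overlapping tuples
  have hsum : (∑ ω : (Fin q → Equiv.Perm (Fin (n + m'))) × Equiv.Perm (Fin n), (slyDistinctTuples n m' q j m ω.1 ω.2 : ℝ)) =
      (∑ f : Fin m → SlyWCycle n q j, if (∀ k l, k ≠ l → (f k).reps ≠ (f l).reps) ∧ SlyVertexDisjoint f then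
          (Fintype.card {ω : (Fin q → Equiv.Perm (Fin (n + m'))) × Equiv.Perm (Fin n) // ∀ k, (f k).Present ω.1 ω.2} : ℝ) else 0) +
        ∑ f : Fin m → SlyWCycle n q j, if (∀ k l, k ≠ l → (f k).reps ≠ (f l).reps) ∧ ¬SlyVertexDisjoint f then
          (Fintype.card {ω : (Fin q → Equiv.Perm (Fin (n + m'))) × Equiv.Perm (Fin n) // ∀ k, (f k).Present ω.1 ω.2} : ℝ) else 0 := by
    have h := sum_slyDistinctTuples (n := n) (m' := m') (q := q) (j := j) m
    have h' : (∑ ω : (Fin q → Equiv.Perm (Fin (n + m'))) × Equiv.Perm (Fin n), (slyDistinctTuples n m' q j m ω.1 ω.2 : ℝ)) =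
        ∑ f : Fin m → SlyWCycle n q j, if (∀ k l, k ≠ l → (f k).reps ≠ (f l).reps) then
          (Fintype.card {ω : (Fin q → Equiv.Perm (Fin (n + m'))) × Equiv.Perm (Fin n) // ∀ k, (f k).Present ω.1 ω.2} : ℝ) else 0 := by
      have := congrArg (fun x : ℕ => (x : ℝ)) h
      push_cast at this
      exact this
    rw [h', ← Finset.sum_add_distrib]
    refine Finset.sum_congr rfl fun f _ => ?_
    by_cases hd : ∀ k l, k ≠ l → (f k).reps ≠ (f l).reps
    · by_cases hv : SlyVertexDisjoint f
      · rw [if_pos hd, if_pos ⟨hd, hv⟩, if_neg (fun h => h.2 hv), add_zero]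
      · rw [if_pos hd, if_neg (fun h => hv h.2), if_pos ⟨hd, hv⟩, zero_add]
    · rw [if_neg hd, if_neg (fun h => hd h.1), if_neg (fun h => hd h.1), add_zero]
  -- the disjoint part is at most the main term
  have hdisj : (∑ f : Fin m → SlyWCycle n q j, if (∀ k l, k ≠ l → (f k).reps ≠ (f l).reps) ∧ SlyVertexDisjoint f then
      (Fintype.card {ω : (Fin q → Equiv.Perm (Fin (n + m'))) × Equiv.Perm (Fin n) // ∀ k, (f k).Present ω.1 ω.2} : ℝ) else 0) ≤
      ∑ f : Fin m → SlyWCycle n q j, if SlyVertexDisjoint f then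
        (((∏ c : Fin q, (n + m' - ∑ k, (f k).colourCount (some c)).factorial) * (n - ∑ k, (f k).colourCount none).factorial : ℕ) : ℝ)
        else 0 := by
    refine Finset.sum_le_sum fun f _ => ?_
    by_cases hv : SlyVertexDisjoint f
    · rw [if_pos hv]
      split_ifs
      · rw [card_present_tuple f hv]
      · exact Nat.cast_nonneg _
    · rw [if_neg hv, if_neg (fun h => hv h.2)]
  rw [hsum, add_div]
  refine add_le_add ((div_le_div_of_nonneg_right hdisj hN.le).trans (sum_disjoint_div_bounds hj m hn).2) ?_
  rw [div_le_iff₀ hN]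
  refine (sum_overlap_le (m' := m') hj0 m hn).trans (le_of_eq ?_)
  ring

end UpperBound

end Literature.Computability.Complexity
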